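import Summits.BirchSwinnertonDyer.BirchSwinnertonDyer.Theorems.GoldfeldAllTwistsTwoConverseTwinInertSevenPartnerRank
import Summits.BirchSwinnertonDyer.BirchSwinnertonDyer.Theorems.GoldfeldAllTwistsTwoConverseTwinAdditiveSplitPrimeTwistDescent
import Summits.BirchSwinnertonDyer.BirchSwinnertonDyer.Theorems.GoldfeldGoodTwistsAllTwistsLeaf
import HarnessLib

set_option linter.dupNamespace false -- namespace `…BirchSwinnertonDyer.BirchSwinnertonDyer…` is the cell's (D-0017 nested layout)
set_option autoImplicit false

/-!
# Twin″ (item 19140), 7-INERT half: NON-VANISHING of `L(49a1^{(ℓ)}, 1)` or `L(49a1^{(aℓ)}, 1)` for split primes `ℓ`,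
# from the complementarity law and Burungale–Tian's rank-zero `2`-converse (named fact)

Cell `bsd-goldfeld`, seat `bsd-goldfeld-s1p-c301` (prover, gen 13); `--supports stmt-BirchSwinnertonDyer-19140` (twin″) as a
HELPER; consumer of `…TwinInertSevenPartnerRank` (rank `0 ∧ Ш[2] = 0` for the `2`-minimal partner). With
`corank_{ℤ₂} Sel_{2^∞} = rank + corank Ш[2^∞]` (`selmerCorank_eq_mordellWeilRank_add_holds`, Greenberg) the minimal partner has
`corank₂ = 0`, and Burungale–Tian's rank-zero `p`-converse for CM curves at `p = 2` (the route's named fact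
`burungaleTian_analyticRank_eq_zero_of_selmerCorank_eq_zero_of_hasCM`, aside item 19554; CM of every model of a twist of
`X₀(49)` by `minimalModel_quadraticTwist_cm7`) gives ANALYTIC RANK `0`:
* **`analyticRank_eq_zero_posTwist_of_symbol_neg`**: `σ(ℓ) = −1` ⇒ `L(W, 1) ≠ 0` (`W.analyticRank = 0`) for every model `W` of
  `49a1^{(ℓ)}`, `ℓ ≡ 5 (mod 8)` prime, `(−7/ℓ) = 1` — a non-vanishing statement for twists of `X₀(49)` by primes SPLIT in
  `ℚ(√−7)` (print — Coates–Li–Tian–Zhai 2015, Coates–Li 2020, Kezuka–Li 2025 — treats INERT prime factors only), conditional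
  on Burungale–Tian exactly as the route's assembly is;
* **`analyticRank_eq_zero_auxTwist_of_symbol_pos`**: `σ(ℓ) = +1` ⇒ the same for every model of `49a1^{(aℓ)}` (`a ≡ 1 (mod 8)`
  prime inert in `ℚ(√−7)`, `(a/ℓ) = −1`);
* **`analyticRank_eq_zero_posTwist_or_auxTwist`**: the two together, `σ`-free.
These are the «individual `L`-values» the inert-half genus road needs (memo `HOME/INERT7-AUXPRIME-HORIZON.md` §2–§3; seat c201
K12PP-INERT7 §2c found `r_an(49a1^{(ℓ)}) = 2` exactly on `σ(ℓ) = +1` primes numerically).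

HONEST FRAMING: CONDITIONAL on the named Burungale–Tian fact (`hBT`), about auxiliary GOOD-reduction twists outside the
additive cell; no case of twin″ or K12₂″ is decided; BSD is not proved by any of this.

References: Burungale–Tian, Invent. Math. 220 (2020) / the route's 2026 form [BurungaleTian2026]; Greenberg LNM 1716 §1
[GreenbergLNM1716]; Silverman, *AEC* X.4 [SilvermanAEC2009].
-/

noncomputable section

open scoped Classical

open WeierstrassCurve Literature.NumberTheory.EllipticCurves

namespace Summit.BirchSwinnertonDyer.BirchSwinnertonDyer.Theorems.GoldfeldGoodTwists

section LValue

variable {l : ℕ} [Fact l.Prime] {a : ℕ} [Fact a.Prime]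

/-- `rank W = 0 ∧ Ш(W)[2] = 0` ⇒ `corank_{ℤ₂} Sel_{2^∞}(W) = 0` ⇒ (Burungale–Tian, `W` CM) `W.analyticRank = 0`.
[cite: GreenbergLNM1716, §1 p. 54] [cite: BurungaleTian2026, Thm. 1.1] -/
theorem analyticRank_eq_zero_of_rank_eq_zero_of_sha_two
    (hBT : burungaleTian_analyticRank_eq_zero_of_selmerCorank_eq_zero_of_hasCM)
    (W : WeierstrassCurve ℚ) [W.IsElliptic] (hCM : W.HasCM)
    (h : W.mordellWeilRank = 0 ∧ ∀ c ∈ W.sha, 2 • c = 0 → c = 0) : W.analyticRank = 0 := by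
  haveI : Fact (Nat.Prime 2) := ⟨Nat.prime_two⟩
  have hcork : W.selmerCorank 2 = 0 := by
    rw [W.selmerCorank_eq_mordellWeilRank_add_holds 2, h.1, W.shaCorank_eq_zero_of_forall 2 h.2]
  exact hBT W hCM 2 hcork

/-- **`σ(ℓ) = −1` ⇒ `L(49a1^{(ℓ)}, 1) ≠ 0`** (analytic rank `0`) for every model `W` of `49a1^{(ℓ)}`, `ℓ ≡ 5 (mod 8)` prime with
`(−7/ℓ) = 1`, granted Burungale–Tian's rank-zero `2`-converse. [cite: BurungaleTian2026, Thm. 1.1]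
[cite: SilvermanAEC2009, Thm. X.4.2(a) and Prop. X.4.9] -/
theorem analyticRank_eq_zero_posTwist_of_symbol_neg
    (hBT : burungaleTian_analyticRank_eq_zero_of_selmerCorank_eq_zero_of_hasCM)
    (hl8 : l % 8 = 5) (hl7 : legendreSym l (-7) = 1) (hσ : ∀ s : ZMod l, s ^ 2 = -7 → ¬ IsSquare (2 * (s - 21)))
    (W : WeierstrassCurve ℚ) [W.IsElliptic] (C : VariableChange ℚ) (hC : C • W = cm7.quadraticTwist ((l : ℤ) : ℚ)) :
    W.analyticRank = 0 :=
  analyticRank_eq_zero_of_rank_eq_zero_of_sha_two hBT W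
    (minimalModel_quadraticTwist_cm7 (by exact_mod_cast (Fact.out : l.Prime).ne_zero) W C hC).2.1
    (rank_eq_zero_and_sha_two_posTwist_of_symbol_neg hl8 hl7 hσ W C hC)

/-- **`σ(ℓ) = +1` ⇒ `L(49a1^{(aℓ)}, 1) ≠ 0`** (analytic rank `0`) for every model `W` of `49a1^{(aℓ)}`, `a ≡ 1 (mod 8)` prime
with `−7 ∉ 𝔽_a²` and `a ∉ 𝔽_ℓ²`, granted Burungale–Tian. [cite: BurungaleTian2026, Thm. 1.1]
[cite: SilvermanAEC2009, Thm. X.4.2(a) and Prop. X.4.9] -/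
theorem analyticRank_eq_zero_auxTwist_of_symbol_pos
    (hBT : burungaleTian_analyticRank_eq_zero_of_selmerCorank_eq_zero_of_hasCM)
    (hl8 : l % 8 = 5) (hl7 : legendreSym l (-7) = 1) (hσ : ∀ s : ZMod l, s ^ 2 = -7 → IsSquare (2 * (s - 21)))
    (ha8 : a % 8 = 1) (ha7 : ¬ IsSquare ((-7 : ℤ) : ZMod a)) (hal : ¬ IsSquare ((a : ℤ) : ZMod l))
    (W : WeierstrassCurve ℚ) [W.IsElliptic] (C : VariableChange ℚ)
    (hC : C • W = cm7.quadraticTwist (((a : ℤ) * l : ℤ) : ℚ)) : W.analyticRank = 0 :=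
  analyticRank_eq_zero_of_rank_eq_zero_of_sha_two hBT W
    (minimalModel_quadraticTwist_cm7 (mul_ne_zero (by exact_mod_cast (Fact.out : a.Prime).ne_zero)
      (by exact_mod_cast (Fact.out : l.Prime).ne_zero)) W C hC).2.1
    (rank_eq_zero_and_sha_two_auxTwist_of_symbol_pos hl8 hl7 hσ ha8 ha7 hal W C hC)

/-- **For every split prime `ℓ ≡ 5 (mod 8)` and admissible auxiliary `a`: `L(49a1^{(ℓ)},1) ≠ 0` or `L(49a1^{(aℓ)},1) ≠ 0`**
(for all models), granted Burungale–Tian — the `σ`-free form. [cite: BurungaleTian2026, Thm. 1.1]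
[cite: SilvermanAEC2009, Thm. X.4.2(a) and Prop. X.4.9] -/
theorem analyticRank_eq_zero_posTwist_or_auxTwist
    (hBT : burungaleTian_analyticRank_eq_zero_of_selmerCorank_eq_zero_of_hasCM)
    (hl8 : l % 8 = 5) (hl7 : legendreSym l (-7) = 1) (ha8 : a % 8 = 1) (ha7 : ¬ IsSquare ((-7 : ℤ) : ZMod a))
    (hal : ¬ IsSquare ((a : ℤ) : ZMod l))
    (W₁ : WeierstrassCurve ℚ) [W₁.IsElliptic] (C₁ : VariableChange ℚ) (hC₁ : C₁ • W₁ = cm7.quadraticTwist ((l : ℤ) : ℚ))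
    (W₂ : WeierstrassCurve ℚ) [W₂.IsElliptic] (C₂ : VariableChange ℚ)
    (hC₂ : C₂ • W₂ = cm7.quadraticTwist (((a : ℤ) * l : ℤ) : ℚ)) :
    W₁.analyticRank = 0 ∨ W₂.analyticRank = 0 := by
  obtain ⟨hl2, hl7', hl4⟩ := prime_ne_two_ne_seven_of_mod_eight_five hl8
  obtain ⟨s, t, hs, ht⟩ := exists_sq_eq_neg_seven_and_sq_eq_seven hl4 hl7
  rcases symbol_dichotomy hl2 hl7' hs ht with hσ | hσ
  · exact Or.inr (analyticRank_eq_zero_auxTwist_of_symbol_pos hBT hl8 hl7 hσ ha8 ha7 hal W₂ C₂ hC₂)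
  · exact Or.inl (analyticRank_eq_zero_posTwist_of_symbol_neg hBT hl8 hl7 hσ W₁ C₁ hC₁)

end LValue

end Summit.BirchSwinnertonDyer.BirchSwinnertonDyer.Theorems.GoldfeldGoodTwists

end
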